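import Literature.Analysis.FluidPDE.PassiveScalarForcedTrace
import Literature.Analysis.FluidPDE.LerayHopfTranslateTorus
import HarnessLib

/-!
# Restarting a sourced weak passive scalar at almost every time — tools (stub RC-R)

Crux `TwoAndHalfD.TwohalfdNeg` (stmt-AnomalousDissipation-0211), line
`log-kantorovich-enstrophy-transfer`, regular-condensate theorem (lead c7), stub RC-R
(`stub_rcRestart`, file `TwoAndHalfDTwohalfdNegRegularCondensateRestart`). This is the tools half:
the TRACE of a sourced weak passive scalar `θ` (`Torus.IsWeakScalarTransportForcedOn`,
`∂ₜθ + u·∇θ = κΔθ + s` on `T^d × [0,T)`, DiPerna–Lions 1989, §II.1) at a good time.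

For a smooth steady field `g` write
`P_g(σ) = ∫ θ₀ g + ∫_{(0,σ]} (∫ θ(τ) (⟪u(τ), ∇g⟫ + κΔg) + ∫ s(τ) g) dτ` for the absolutely
continuous representative of `t ↦ ∫ θ(t) g` (`PassiveScalarSteadyTest`).

* `integral_mul_eq_trace_of_forall_molInt_eq` — if at the time `a` the mollified solution
  `θ(a) ⋆ kₙ` equals the continuous mollified primitive `(θ₀ ⋆ kₙ) + ∫_{(0,a]} (Gₙ + s ⋆ kₙ)`
  pointwise, for every kernel of a sequence `kₙ` of even smooth unit-mass kernels shrinking to a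
  point, then `∫ θ(a) g = P_g(a)` for EVERY smooth `g`: pair the mollified primitive with `g`
  (`PassiveScalarForcedTrace.integral_molIntRep_mul_eq_trace`: `∫ θ(a) (g ⋆ kₙ) = P_{g ⋆ kₙ}(a)`)
  and let `n → ∞` (`tendsto_trace_convolution`, `tendsto_integral_mul_convolution`).
* `ae_memLp_and_forall_integral_mul_eq_trace` — for a GLOBAL solution the hypothesis holds at
  a.e. `a > 0` (`PassiveScalarForcedMollified.ae_forall_molInt_eq_datum_add_setIntegral_flux` along
  the kernels `Torus.kernel (1/(4(n+1)))` and the integer horizons: countably many null sets), so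
  the good set does not depend on `g`; moreover `θ(a) ∈ L²` there.
* `exists_ae_abs_pairing_translate_sub_le` — at a good time, for a space–time test function `ψ`,
  `∫ θ(t + a) ψ(t) → ∫ θ(a) ψ(0)` along a.e. `t → 0⁺` (continuity of the trace `P_{ψ(0)}`, the
  `L^∞L²` bound and the mean value theorem in time) — the input of the cut-off argument of the
  main file.

Supports stmt-AnomalousDissipation-0211. Sources: R. J. DiPerna, P.-L. Lions, Invent. Math. 98
(1989), §II.1 (13)–(14) [`DiPernaLions1989`]. Not here: the cut-off argument and the translated
solution structure (main file), anything about the energy inequality (stub RC-K).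
-/

noncomputable section

namespace Summit.AnomalousDissipation.AnomalousDissipation.Theorems.TwohalfdNeg.RegularCondensate

open MeasureTheory Filter Topology Set Function Metric
open scoped ENNReal NNReal InnerProductSpace Convolution ContDiff
open Literature.Analysis.FunctionSpaces Literature.Analysis.FluidPDE

-- the summit and the problem are both `AnomalousDissipation` (path convention), hence the dup:
set_option linter.dupNamespace false

variable {d : Type*} [Fintype d]

/-- **Pairings with mollified smooth fields converge**: for integrable `f`, smooth `g` and
kernels `kₙ ≥ 0` of unit mass with `support kₙ ⊆ B(0, δₙ)`, `δₙ → 0`,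
`∫ f (g ⋆ kₙ) → ∫ f g` (uniform convergence `g ⋆ kₙ → g`, dominated convergence). [folklore] -/
theorem tendsto_integral_mul_convolution {f : UnitAddTorus d → ℝ} (hf : Integrable f volume)
    {g : UnitAddTorus d → ℝ} (hg : Torus.IsSmooth g) {k : ℕ → UnitAddTorus d → ℝ} {δ : ℕ → ℝ}
    (hkS : ∀ n, Torus.IsSmooth (k n)) (hk0 : ∀ n y, 0 ≤ k n y) (hk1 : ∀ n, ∫ y, k n y = 1)
    (hks : ∀ n, support (k n) ⊆ ball 0 (δ n)) (hδ : Tendsto δ atTop (𝓝 0)) :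
    Tendsto (fun n => ∫ y, f y * (g ⋆ k n) y) atTop (𝓝 (∫ y, f y * g y)) := by
  have hgi : Integrable g volume := hg.continuous.integrable_unitAddTorus
  have hgn : ∀ n, Torus.IsSmooth (g ⋆ k n) := fun n => Torus.isSmooth_convolution hgi (hkS n)
  obtain ⟨Cg, hCg⟩ := Torus.exists_forall_norm_le_of_continuous hg.continuous
  have hbg : ∀ n y, |(g ⋆ k n) y| ≤ Cg := fun n y =>
    Torus.abs_convolution_le_of_forall_abs_le hg.continuous.aestronglyMeasurable
      (fun x => by rw [← Real.norm_eq_abs]; exact hCg x) (hk0 n) (hk1 n) y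
  have hpg : ∀ y, Tendsto (fun n => (g ⋆ k n) y) atTop (𝓝 (g y)) :=
    Torus.IsWeakScalarTransportForcedOn.tendsto_apply_of_eventually_forall_norm_sub_le fun η hη => by
      filter_upwards [Torus.eventually_forall_abs_convolution_sub_le hg.continuous hk0 hk1 hks hδ hη]
        with n hn y
      rw [Real.norm_eq_abs]; exact hn y
  refine tendsto_integral_of_dominated_convergence (fun y => Cg * |f y|) (fun n => ?_) (hf.abs.const_mul Cg)
    (fun n => Eventually.of_forall fun y => ?_) (Eventually.of_forall fun y => (hpg y).const_mul (f y))
  · exact hf.aestronglyMeasurable.mul (hgn n).continuous.aestronglyMeasurable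
  · rw [norm_mul, Real.norm_eq_abs, Real.norm_eq_abs, mul_comm]
    exact mul_le_mul_of_nonneg_right (hbg n y) (abs_nonneg _)

section Trace

variable {T κ : ℝ} {u : ℝ → UnitAddTorus d → EuclideanSpace ℝ d} {s : ℝ → UnitAddTorus d → ℝ}
  {θ₀ : UnitAddTorus d → ℝ} {θ : ℝ → UnitAddTorus d → ℝ}

/-- **The slice at a good time, paired with any smooth field, is the trace.** If at the time
`a < T` the slice `θ a` is integrable and the mollified solution `θ(a) ⋆ kₙ` coincides, for
every kernel of a sequence of even smooth unit-mass kernels `kₙ ≥ 0` shrinking to a point, with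
the continuous mollified primitive `(θ₀ ⋆ kₙ) + ∫_{(0,a]} (Gₙ + s ⋆ kₙ)` at every point, then
for EVERY smooth `g`,
`∫ θ(a) g = ∫ θ₀ g + ∫_{(0,a]} (∫ θ(τ) (⟪u(τ), ∇g⟫ + κ Δg) + ∫ s(τ) g) dτ`
(`∫ θ(a) (g ⋆ kₙ) = P_{g ⋆ kₙ}(a)` by the adjoint of the mollified flux, then `n → ∞`).
[cite: DiPernaLions1989, §II.1 (13)–(14)] -/
theorem integral_mul_eq_trace_of_forall_molInt_eq
    (H : Torus.IsWeakScalarTransportForcedOn T κ u s θ₀ θ) (hθ₀ : Integrable θ₀ volume)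
    {a : ℝ} (haT : a < T) (hθa : Integrable (θ a) volume)
    {k : ℕ → UnitAddTorus d → ℝ} {δ : ℕ → ℝ} (hkS : ∀ n, Torus.IsSmooth (k n))
    (hk0 : ∀ n y, 0 ≤ k n y) (hk1 : ∀ n, ∫ y, k n y = 1) (hks : ∀ n, support (k n) ⊆ ball 0 (δ n))
    (hδ : Tendsto δ atTop (𝓝 0)) (hke : ∀ n z, k n (-z) = k n z)
    (hgood : ∀ n x, ∫ y, θ a y * k n (x - y) = (∫ y, θ₀ y * k n (x - y)) +
      ∫ τ in Ioc 0 a, ((∫ y, θ τ y *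
        (-⟪u τ y, Torus.gradient (k n) (x - y)⟫_ℝ + κ * Torus.laplacian (k n) (x - y))) +
        ∫ y, s τ y * k n (x - y)))
    {g : UnitAddTorus d → ℝ} (hg : Torus.IsSmooth g) :
    ∫ x, θ a x * g x = (∫ y, θ₀ y * g y) + ∫ τ in Ioc 0 a, ((∫ y, θ τ y *
        (⟪u τ y, Torus.gradient g y⟫_ℝ + κ * Torus.laplacian g y)) + ∫ y, s τ y * g y) := by
  have hL : ∀ n, ∫ y, θ a y * (g ⋆ k n) y = (∫ y, θ₀ y * (g ⋆ k n) y) + ∫ τ in Ioc 0 a, ((∫ y, θ τ y *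
      (⟪u τ y, Torus.gradient (g ⋆ k n) y⟫_ℝ + κ * Torus.laplacian (g ⋆ k n) y)) +
      ∫ y, s τ y * (g ⋆ k n) y) := by
    intro n
    rw [← Torus.integral_mul_molInt_eq hg.continuous hθa (hkS n).continuous (hke n),
      ← H.integral_molIntRep_mul_eq_trace hθ₀ (hkS n) (hke n) hg haT]
    refine integral_congr_ae (Eventually.of_forall fun x => ?_)
    dsimp only
    rw [hgood n x, mul_comm]
  have h1 := tendsto_integral_mul_convolution hθa hg hkS hk0 hk1 hks hδ
  have h2 := H.tendsto_trace_convolution hθ₀ hg hkS hk0 hk1 hks hδ haT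
  exact tendsto_nhds_unique (h1.congr hL) h2

end Trace

section GoodTimes

variable {κ : ℝ} {u : ℝ → UnitAddTorus d → EuclideanSpace ℝ d} {s : ℝ → UnitAddTorus d → ℝ}
  {θ₀ : UnitAddTorus d → ℝ} {θ : ℝ → UnitAddTorus d → ℝ}

/-- **Good restarting times are of full measure.** For a global sourced weak passive scalar
with integrable datum, for a.e. `a > 0`: `θ(a) ∈ L²` and, for EVERY smooth `g`,
`∫ θ(a) g = ∫ θ₀ g + ∫_{(0,a]} (∫ θ(τ) (⟪u(τ), ∇g⟫ + κ Δg) + ∫ s(τ) g) dτ` — the null set does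
not depend on `g`: it is where, along the fixed sequence of kernels `kernel (1/(4(n+1)))`, the
mollified solution equals its continuous mollified primitive (countably many null sets, over
the kernels and the integer horizons). [cite: DiPernaLions1989, §II.1 (13)–(14)] -/
theorem ae_memLp_and_forall_integral_mul_eq_trace (hsol : Torus.IsWeakScalarTransportForced κ u s θ₀ θ)
    (hθ₀ : Integrable θ₀ volume) :
    ∀ᵐ a ∂(volume.restrict (Ioi (0 : ℝ))), MemLp (θ a) 2 volume ∧
      ∀ g : UnitAddTorus d → ℝ, Torus.IsSmooth g →
        ∫ x, θ a x * g x = (∫ y, θ₀ y * g y) + ∫ τ in Ioc 0 a, ((∫ y, θ τ y *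
          (⟪u τ y, Torus.gradient g y⟫_ℝ + κ * Torus.laplacian g y)) + ∫ y, s τ y * g y) := by
  obtain ⟨hε, hε', hε0⟩ := Torus.molRadius_spec
  set k : ℕ → UnitAddTorus d → ℝ := fun n => Torus.kernel (d := d) (1 / (4 * ((n : ℝ) + 1))) with hk
  have hkS : ∀ n, Torus.IsSmooth (k n) := fun n => Torus.isSmooth_kernel (hε n) (hε' n)
  have hk0 : ∀ n y, 0 ≤ k n y := fun n y => Torus.kernel_nonneg (hε n).le y
  have hk1 : ∀ n, ∫ y, k n y = 1 := fun n => Torus.integral_kernel (hε n) (hε' n)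
  have hks : ∀ n, support (k n) ⊆ ball 0 (1 / (4 * ((n : ℝ) + 1))) := fun n =>
    Torus.support_kernel_subset (hε n)
  have hke : ∀ n z, k n (-z) = k n z := fun n z => Torus.kernel_neg (hε n) (hε' n) z
  have hn : ∀ n : ℕ, ∀ᵐ a ∂(volume : Measure ℝ), a ∈ Ioo (0 : ℝ) ((n : ℝ) + 1) →
      MemLp (θ a) 2 volume ∧ ∀ m x, ∫ y, θ a y * k m (x - y) = (∫ y, θ₀ y * k m (x - y)) +
        ∫ τ in Ioc 0 a, ((∫ y, θ τ y *
          (-⟪u τ y, Torus.gradient (k m) (x - y)⟫_ℝ + κ * Torus.laplacian (k m) (x - y))) +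
          ∫ y, s τ y * k m (x - y)) := by
    intro n
    have H := hsol ((n : ℝ) + 1) (by positivity)
    rw [← ae_restrict_iff' measurableSet_Ioo]
    have h2 := ae_all_iff.2 fun m => H.ae_forall_molInt_eq_datum_add_setIntegral_flux hθ₀ (hkS m)
    filter_upwards [H.ae_memLp_two, h2] with a h1 h2
    exact ⟨h1, h2⟩
  rw [← ae_all_iff] at hn
  rw [ae_restrict_iff' measurableSet_Ioi]
  filter_upwards [hn] with a ha ha0
  obtain ⟨n, hn⟩ := exists_nat_gt a
  have haT : a < (n : ℝ) + 1 := by linarith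
  obtain ⟨hmem, hgood⟩ := ha n ⟨ha0, haT⟩
  exact ⟨hmem, fun g hg => integral_mul_eq_trace_of_forall_molInt_eq (hsol ((n : ℝ) + 1) (by positivity))
    hθ₀ haT (hmem.integrable one_le_two) hkS hk0 hk1 hks hε0 hke hgood hg⟩

end GoodTimes

section Pairing

variable {T κ a : ℝ} {u : ℝ → UnitAddTorus d → EuclideanSpace ℝ d} {s : ℝ → UnitAddTorus d → ℝ}
  {θ₀ : UnitAddTorus d → ℝ} {θ : ℝ → UnitAddTorus d → ℝ} {ψ : ℝ → UnitAddTorus d → ℝ}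

/-- **The pairing of the translate with a test function at `t → 0⁺`, almost everywhere.** Let
`θ` be a sourced weak passive scalar on `[0, T + a)` (`T, a > 0`) whose slice at `a`, paired
with `ψ(0, ·)`, equals the trace `P_{ψ(0)}(a)`, and let `ψ` be a space–time test function on
`[0, T)`. Then `∫ θ(t + a) ψ(t) → ∫ θ(a) ψ(0)` along a.e. `t → 0⁺`: for every `ε > 0` there is
`τ₀ > 0` with `|∫ θ(t + a) ψ(t) - ∫ θ(a) ψ(0)| ≤ ε` for a.e. `t ∈ (0, τ₀)`. Indeed, for a.e.
`t`, `∫ θ(t + a) ψ(0) = P_{ψ(0)}(t + a)` (`PassiveScalarSteadyTest`), the trace is continuous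
(primitive of an integrable function), and `|∫ θ(t + a) (ψ(t) - ψ(0))| ≤ ‖θ(t + a)‖_{L¹} Ct`
by the `L^∞L²` bound and the mean value theorem in time. [cite: DiPernaLions1989, §II.1 (13)–(14)] -/
theorem exists_ae_abs_pairing_translate_sub_le
    (H : Torus.IsWeakScalarTransportForcedOn (T + a) κ u s θ₀ θ) (ha : 0 < a) (hT : 0 < T)
    (hψ : Torus.IsSpaceTimeTest T ψ)
    (htr : ∫ x, θ a x * ψ 0 x = (∫ y, θ₀ y * ψ 0 y) + ∫ τ in Ioc 0 a, ((∫ y, θ τ y *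
        (⟪u τ y, Torus.gradient (ψ 0) y⟫_ℝ + κ * Torus.laplacian (ψ 0) y)) + ∫ y, s τ y * ψ 0 y)) :
    ∀ ε > 0, ∃ τ₀ > 0, ∀ᵐ t ∂(volume.restrict (Ioo 0 τ₀)),
      |(∫ x, θ (t + a) x * ψ t x) - ∫ x, θ a x * ψ 0 x| ≤ ε := by
  have hφs : Torus.IsSmooth (ψ 0) := hψ.isSmooth_slice 0
  set F : ℝ → ℝ := fun τ => (∫ y, θ τ y *
    (⟪u τ y, Torus.gradient (ψ 0) y⟫_ℝ + κ * Torus.laplacian (ψ 0) y)) + ∫ y, s τ y * ψ 0 y with hF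
  set prim : ℝ → ℝ := fun σ => ∫ τ in Ioc 0 σ, F τ with hprim
  set L : ℝ := ∫ x, θ a x * ψ 0 x with hL
  set U : ℝ → ℝ := fun t => ∫ x, θ (t + a) x * ψ t x with hU
  -- the trace is continuous at `a`
  have hFi : IntegrableOn F (Ioo 0 (T + a)) :=
    (H.integrable_mul_steadyFlux hφs).integral_prod_left.add
      (H.integrable_source_mul_continuous hφs.continuous).integral_prod_left
  have hFi' : IntegrableOn F (Icc 0 (T + a)) := by
    rw [integrableOn_Icc_iff_integrableOn_Ioo]
    exact hFi
  have hprimc : ContinuousAt prim a :=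
    (intervalIntegral.continuousOn_primitive hFi').continuousAt (Icc_mem_nhds ha (by linarith))
  -- the a.e. trace and the `L^∞L²` bound, translated to `(0, T)`
  have hsub : Ioo (0 + a) (T + a) ⊆ Ioo 0 (T + a) := fun t ht => ⟨by linarith [ht.1], ht.2⟩
  have hμ : volume.restrict (Ioo (0 + a) (T + a)) ≤ volume.restrict (Ioo 0 (T + a)) :=
    Measure.restrict_mono hsub le_rfl
  obtain ⟨C, hC⟩ := H.exists_eLpNorm_le
  have hae : ∀ᵐ t ∂(volume.restrict (Ioo 0 T)), (MemLp (θ (t + a)) 2 volume ∧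
      eLpNorm (θ (t + a)) 2 volume ≤ C) ∧ ∫ x, θ (t + a) x * ψ 0 x = (∫ y, θ₀ y * ψ 0 y) + prim (t + a) := by
    have h1 : ∀ᵐ t ∂(volume.restrict (Ioo 0 (T + a))), (MemLp (θ t) 2 volume ∧
        eLpNorm (θ t) 2 volume ≤ C) ∧ ∫ x, θ t x * ψ 0 x = (∫ y, θ₀ y * ψ 0 y) + prim t := by
      filter_upwards [H.ae_memLp_two, hC, H.ae_integral_mul_eq hφs] with t h1 h2 h3
      exact ⟨⟨h1, h2⟩, h3⟩
    exact ae_restrict_Ioo_comp_add_right a (ae_mono hμ h1)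
  -- the test function is Lipschitz in time, uniformly in `x`, on `[0, T]`
  obtain ⟨C₁, hC₁⟩ := Torus.exists_bound_of_continuous_uncurry hψ.continuous_uncurry_timeDeriv 0 T
  have hC₁0 : 0 ≤ C₁ := (norm_nonneg _).trans (hC₁ 0 ⟨le_rfl, hT.le⟩ 0)
  have hψlip : ∀ t ∈ Icc (0 : ℝ) T, ∀ x, |ψ t x - ψ 0 x| ≤ C₁ * t := by
    intro t ht x
    have hd : ∀ τ ∈ Icc (0 : ℝ) T, DifferentiableAt ℝ (fun τ => ψ τ x) τ := fun τ _ =>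
      (Torus.differentiable_apply_of_contDiff_stLift hψ.1 x) τ
    have hb : ∀ τ ∈ Icc (0 : ℝ) T, ‖deriv (fun τ => ψ τ x) τ‖ ≤ C₁ := fun τ hτ => hC₁ τ hτ x
    have h := (convex_Icc (0 : ℝ) T).norm_image_sub_le_of_norm_deriv_le hd hb (left_mem_Icc.2 hT.le) ht
    rwa [Real.norm_eq_abs, Real.norm_eq_abs, sub_zero, abs_of_nonneg ht.1] at h
  -- the a.e. estimate on `(0, T)`
  have hest : ∀ᵐ t ∂(volume.restrict (Ioo 0 T)), |U t - L| ≤ C * (C₁ * t) + |prim (t + a) - prim a| := by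
    filter_upwards [hae, ae_restrict_mem measurableSet_Ioo] with t ht htI
    obtain ⟨⟨hm, hmC⟩, htrt⟩ := ht
    have hθi : Integrable (θ (t + a)) volume := hm.integrable one_le_two
    obtain ⟨K, hK⟩ := Torus.exists_forall_norm_le_of_continuous (hψ.isSmooth_slice t).continuous
    obtain ⟨K₀, hK₀⟩ := Torus.exists_forall_norm_le_of_continuous hφs.continuous
    have i1 : Integrable (fun x => θ (t + a) x * (ψ t x - ψ 0 x)) volume :=
      hθi.mul_bdd ((hψ.isSmooth_slice t).continuous.sub hφs.continuous).aestronglyMeasurable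
        (ae_of_all _ fun x => (norm_sub_le _ _).trans (add_le_add (hK x) (hK₀ x)))
    have i2 : Integrable (fun x => θ (t + a) x * ψ 0 x) volume :=
      hθi.mul_bdd hφs.continuous.aestronglyMeasurable (ae_of_all _ fun x => hK₀ x)
    have e : U t - L = (∫ x, θ (t + a) x * (ψ t x - ψ 0 x)) + (prim (t + a) - prim a) := by
      have h1 : U t = (∫ x, θ (t + a) x * (ψ t x - ψ 0 x)) + ∫ x, θ (t + a) x * ψ 0 x := by
        rw [← integral_add i1 i2]
        exact integral_congr_ae (ae_of_all _ fun x => by ring)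
      have hLa : L = (∫ y, θ₀ y * ψ 0 y) + prim a := htr
      rw [h1, htrt, hLa]
      ring
    rw [e]
    refine (abs_add_le _ _).trans (add_le_add ?_ le_rfl)
    calc |∫ x, θ (t + a) x * (ψ t x - ψ 0 x)| ≤ ∫ x, |θ (t + a) x| * (C₁ * t) := by
          rw [← Real.norm_eq_abs]
          refine norm_integral_le_of_norm_le (hθi.abs.mul_const _) (ae_of_all _ fun x => ?_)
          rw [norm_mul, Real.norm_eq_abs, Real.norm_eq_abs]
          exact mul_le_mul_of_nonneg_left (hψlip t (Ioo_subset_Icc_self htI) x) (abs_nonneg _)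
      _ = (∫ x, |θ (t + a) x|) * (C₁ * t) := integral_mul_const _ _
      _ ≤ C * (C₁ * t) :=
          mul_le_mul_of_nonneg_right (Torus.integral_abs_le_of_eLpNorm_le hm hmC) (mul_nonneg hC₁0 htI.1.le)
  -- the deterministic majorant tends to zero
  have hdet : Tendsto (fun t => C * (C₁ * t) + |prim (t + a) - prim a|) (𝓝[>] 0) (𝓝 0) := by
    have h1 : Tendsto (fun t : ℝ => (C : ℝ) * (C₁ * t)) (𝓝 0) (𝓝 (C * (C₁ * 0))) :=
      (tendsto_id.const_mul C₁).const_mul (C : ℝ)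
    have h2 : Tendsto (fun t : ℝ => prim (t + a)) (𝓝 0) (𝓝 (prim a)) := by
      have h : Tendsto (fun t : ℝ => t + a) (𝓝 0) (𝓝 (0 + a)) := (continuous_id.add continuous_const).tendsto 0
      rw [zero_add] at h
      exact hprimc.tendsto.comp h
    have h3 : Tendsto (fun t => |prim (t + a) - prim a|) (𝓝 0) (𝓝 0) := by
      simpa using (h2.sub_const (prim a)).abs
    have h4 := h1.add h3
    rw [mul_zero, mul_zero, zero_add] at h4
    exact h4.mono_left nhdsWithin_le_nhds
  intro ε hε
  have hev : ∀ᶠ t in 𝓝[>] (0 : ℝ), C * (C₁ * t) + |prim (t + a) - prim a| < ε ∧ t ∈ Ioo 0 T :=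
    ((tendsto_order.1 hdet).2 ε hε).and (Ioo_mem_nhdsGT hT)
  obtain ⟨τ₀, hτ₀, hsub0⟩ := mem_nhdsGT_iff_exists_Ioo_subset.1 hev
  refine ⟨τ₀, hτ₀, ?_⟩
  have hsubT : Ioo 0 τ₀ ⊆ Ioo 0 T := fun t ht => (hsub0 ht).2
  filter_upwards [ae_restrict_of_ae_restrict_of_subset hsubT hest, ae_restrict_mem measurableSet_Ioo]
    with t h1 h2
  exact h1.trans (hsub0 h2).1.le

end Pairing

/-! ## The registered tools sub-stub -/

/-- **RC-R tools `stub_rcRestartTools` (registered sub-stub; the conjunction of this file's two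
exported tools on `T²`, verbatim):** (i) for a global sourced weak passive scalar with integrable
datum, a.e. `a > 0` is a good restarting time — `θ(a) ∈ L²` and `∫ θ(a) g = P_g(a)` for every
smooth `g` (`ae_memLp_and_forall_integral_mul_eq_trace`); (ii) at a time where the slice pairs with
`ψ(0)` to the trace, `∫ θ(t + a) ψ(t) → ∫ θ(a) ψ(0)` along a.e. `t → 0⁺`
(`exists_ae_abs_pairing_translate_sub_le`). [cite: DiPernaLions1989, §II.1 (13)–(14)] -/
theorem stub_rcRestartTools :
    (∀ (κ : ℝ) (u : ℝ → UnitAddTorus (Fin 2) → EuclideanSpace ℝ (Fin 2)) (s : ℝ → UnitAddTorus (Fin 2) → ℝ)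
        (θ₀ : UnitAddTorus (Fin 2) → ℝ) (θ : ℝ → UnitAddTorus (Fin 2) → ℝ),
        Integrable θ₀ volume → Torus.IsWeakScalarTransportForced κ u s θ₀ θ →
        ∀ᵐ a ∂(volume.restrict (Set.Ioi (0 : ℝ))), MemLp (θ a) 2 volume ∧
          ∀ g : UnitAddTorus (Fin 2) → ℝ, Torus.IsSmooth g →
            ∫ x, θ a x * g x = (∫ y, θ₀ y * g y) + ∫ τ in Set.Ioc 0 a, ((∫ y, θ τ y *
              (inner ℝ (u τ y) (Torus.gradient g y) + κ * Torus.laplacian g y)) + ∫ y, s τ y * g y)) ∧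
    (∀ (T κ a : ℝ) (u : ℝ → UnitAddTorus (Fin 2) → EuclideanSpace ℝ (Fin 2)) (s : ℝ → UnitAddTorus (Fin 2) → ℝ)
        (θ₀ : UnitAddTorus (Fin 2) → ℝ) (θ ψ : ℝ → UnitAddTorus (Fin 2) → ℝ),
        Torus.IsWeakScalarTransportForcedOn (T + a) κ u s θ₀ θ → 0 < a → 0 < T → Torus.IsSpaceTimeTest T ψ →
        (∫ x, θ a x * ψ 0 x = (∫ y, θ₀ y * ψ 0 y) + ∫ τ in Set.Ioc 0 a, ((∫ y, θ τ y *
          (inner ℝ (u τ y) (Torus.gradient (ψ 0) y) + κ * Torus.laplacian (ψ 0) y)) + ∫ y, s τ y * ψ 0 y)) →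
        ∀ ε > 0, ∃ τ₀ > 0, ∀ᵐ t ∂(volume.restrict (Set.Ioo 0 τ₀)),
          |(∫ x, θ (t + a) x * ψ t x) - ∫ x, θ a x * ψ 0 x| ≤ ε) :=
  ⟨fun _ _ _ _ _ hθ₀ hsol => ae_memLp_and_forall_integral_mul_eq_trace hsol hθ₀,
    fun _ _ _ _ _ _ _ _ H ha hT hψ htr => exists_ae_abs_pairing_translate_sub_le H ha hT hψ htr⟩

end Summit.AnomalousDissipation.AnomalousDissipation.Theorems.TwohalfdNeg.RegularCondensate

end
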